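import Literature.Topology.FourManifolds.SurfaceCylinderTheorem
import Literature.Topology.FourManifolds.HomotopyTwoSphereNoSaddle
import Literature.Topology.FourManifolds.RegularLevelSplitting
import Literature.Topology.FourManifolds.RegularSlabCobordism
import HarnessLib

/-!
# Cutting a closed oriented surface between its two saddles: both halves are cylinders

Topic `Literature/Topology/FourManifolds`; a brick for the named fact
`Literature.Topology.FourManifolds.nonempty_diffeomorph_sphere_four_of_sblf_genus_one_noLefschetz`
(Baykur–Kamada 2015, Lemma 11) of `SimplifiedBrokenLefschetzFibration.lean`: its printed proof
(Baykur–Kamada 2015, §2, §5) identifies the higher side of a genus-`1` simplified broken Lefschetz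
fibration with `T² × D²`, i.e. invokes the classification of closed orientable surfaces in genus
`1`.  Hirsch's Morse-theoretic proof of that classification (Hirsch 1976, Ch. 9 §3, Thm. 3.5 with
Lemma 3.2 and Thm. 3.7; Matsumoto 2002, §1.5 (b) and Thm. 3.35) cuts the surface at regular levels
into a disc, `1`-handle cobordisms and a disc.  This file proves the cutting step for the torus:
**on a closed smooth surface carrying a smooth orientation, a Morse function with one minimum,
one maximum and two saddles has a regular level between the two saddle values whose sublevel and
superlevel sets are both cylinders `S¹ × [0, 1]`**, each a product cobordism between the two
circles into which that level splits.  Everything here is **proved**; the two definitions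
(`RegularSublevel.boundaryPieceOff`, `RegularSublevel.splitCobordism`) are explicit constructions,
no named fact is introduced.

* `RegularSublevel.boundaryPieceOff h C` — for a regular sublevel set `Mᵃ = {f ≤ a}` of a
  manifold without boundary (`RegularLevelSplitting.lean`) and a closed `C ⊆ M`, the open piece
  `{z ∈ ∂Mᵃ | z ∉ C}` of the boundary manifold `∂Mᵃ`.
* `RegularSublevel.splitCobordism h …` — **a regular sublevel set whose boundary level
  `f⁻¹(a) = K ⊔ K'` is split into two disjoint closed pieces is a cobordism from `K` to `K'`**
  (Milnor 1965, Def. 1.1 with Lemma 2.9; the ends are the open pieces of `∂Mᵃ` off `K'` and off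
  `K`, embedded by the boundary inclusion, `BoundaryManifold.isSmoothEmbedding_opens_val`).
* `exists_lowestSaddle` — the lowest-saddle configuration of `SaddleLevelCircle.lean`
  (`LowestSaddle`: Milnor boxes about the minimum and the lowest saddle, a gap above the saddle
  value) for a Morse function with one minimum, one maximum and at least one saddle, after the
  usual normalisation making the critical values distinct (Milnor 1965, Lemma 2.8 / Thm. 4.1;
  the construction of `HomotopyTwoSphereNoSaddle.lean`, here recorded as a theorem).
* `exists_isTrivial_sublevel_superlevel` — **the cutting theorem**: for such a Morse function
  with exactly two saddles on a closed surface with a smooth orientation, at the level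
  `c = f(s) + δ` just above the lowest saddle `s` (below every other critical value but the
  minimum) the level `f⁻¹(c)` is the disjoint union of two non-empty closed sets `K`, `K'`
  (`LowestSaddle.exists_level_split`: on an oriented surface the `1`-handle is untwisted), and both
  the sublevel set `{f ≤ c}` and the superlevel set `{c ≤ f}` are product cobordisms from `K` to
  `K'`: each is connected (one minimum, resp. one maximum: `RegularSublevel.connectedSpace`,
  Reeb's argument), has Euler characteristic `#min - #saddles = 1 - 1 = 0` by the Morse equality
  for the adapted Morse function `f|{f ≤ c}` (`RegularSublevel.morseData`,
  `IsMorseAdapted.finRelHomology_empty`), and the cylinder theorem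
  (`Cobordism.isTrivial_of_relEuler_empty_eq_zero`, `SurfaceCylinderTheorem.lean`) applies.
* `exists_nonempty_diffeomorph_sublevel_superlevel_cylinder` — hence both halves are
  diffeomorphic to `S¹ × [0, 1]` and `K`, `K'` are circles.

The assembly of the two cylinders into `S¹ × S¹` (Hirsch 1976, Thm. 9.3.5 in genus `1`) is left
to a sequel.

## References

* M. W. Hirsch, *Differential Topology*, GTM 33 (1976), Ch. 9 §3: Lemma 3.2, Thm. 3.5 and its
  proof, Thm. 3.7 (PDF pp. 186–189 of the held copy). [HirschDT1976]
* Y. Matsumoto, *An Introduction to Morse Theory*, Transl. Math. Monogr. 208 (2002), §1.5 (b)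
  (PDF pp. 48–49), Thm. 3.35. [Matsumoto2001]
* J. Milnor, *Lectures on the h-cobordism theorem*, Princeton (1965), Def. 1.1, Lemma 2.8,
  Lemma 2.9, Def. 3.1, Thm. 3.4, Thm. 4.1. [MilnorHCobordism1965]
* J. Milnor, *Morse theory*, Ann. of Math. Studies 51 (1963), Thm. 3.1, §3. [Milnor1963]
* R. İ. Baykur, S. Kamada, *Classification of broken Lefschetz fibrations with small fiber
  genera*, J. Math. Soc. Japan 67 (2015), §2, §5, Lemma 11. [BaykurKamada2015]
-/

noncomputable section

open scoped Manifold ContDiff Topology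
open Set Function Filter Module
open Literature.AlgebraicTopology.SingularHomology

namespace Literature.Topology.FourManifolds

universe u

/-! ### A regular sublevel set with split boundary level as a cobordism -/

namespace RegularSublevel

section Split

variable {k : ℕ} {M : Type u} [TopologicalSpace M] [ChartedSpace (EuclideanSpace ℝ (Fin (k + 1))) M]
  [IsManifold (𝓡 (k + 1)) ∞ M] {f : M → ℝ} {a : ℝ} (h : IsRegularLevel (𝓡 (k + 1)) f a)

/-- **The open piece of `∂Mᵃ` off a closed set `C ⊆ M`**: the boundary points `z` of the regular
sublevel set `Mᵃ = {f ≤ a}` with `z ∉ C`, an open subset of the boundary manifold `∂Mᵃ` (hence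
a smooth `k`-manifold in its own right). [cite: Milnor1963, Thm. 3.1] -/
def boundaryPieceOff (C : Set M) (hC : IsClosed C) :
    TopologicalSpace.Opens ((𝓡∂ (k + 1)).boundary (RegularSublevel h)) :=
  ⟨{z | incl h z.1 ∉ C}, by
    have hc : Continuous fun z : (𝓡∂ (k + 1)).boundary (RegularSublevel h) => incl h z.1 :=
      (continuous_incl h).comp continuous_subtype_val
    exact (hC.preimage hc).isOpen_compl⟩

/-- Membership in the open piece off `C` (definitional unfolding). [folklore] -/
@[simp]
theorem mem_boundaryPieceOff {C : Set M} {hC : IsClosed C}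
    {z : (𝓡∂ (k + 1)).boundary (RegularSublevel h)} :
    z ∈ boundaryPieceOff h C hC ↔ incl h z.1 ∉ C :=
  Iff.rfl

/-- Points of the open piece lie on the level `f = a`. [cite: Milnor1963, Thm. 3.1] -/
theorem apply_boundaryPieceOff {C : Set M} {hC : IsClosed C} (p : boundaryPieceOff h C hC) :
    f (incl h p.1.1) = a :=
  apply_incl_boundary h p.1

/-- If the level `f⁻¹(a)` is covered by `K ∪ K'`, the open piece off `K'` lies over `K`.
[folklore] -/
theorem incl_mem_of_boundaryPieceOff {K K' : Set M} {hK' : IsClosed K'}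
    (hunion : K ∪ K' = f ⁻¹' {a}) (p : boundaryPieceOff h K' hK') : incl h p.1.1 ∈ K := by
  have hmem : incl h p.1.1 ∈ K ∪ K' := by
    rw [hunion]
    exact apply_boundaryPieceOff h p
  exact hmem.resolve_right p.2

/-- The open piece off `K'` is the preimage of `K`, when `f⁻¹(a) = K ⊔ K'`. [folklore] -/
theorem coe_boundaryPieceOff_eq {K K' : Set M} {hK' : IsClosed K'} (hdisj : Disjoint K K')
    (hunion : K ∪ K' = f ⁻¹' {a}) :
    ((boundaryPieceOff h K' hK' : TopologicalSpace.Opens _) :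
        Set ((𝓡∂ (k + 1)).boundary (RegularSublevel h))) =
      {z | incl h z.1 ∈ K} := by
  ext z
  simp only [TopologicalSpace.Opens.coe_mk, mem_setOf_eq, boundaryPieceOff]
  constructor
  · intro hz
    have hmem : incl h z.1 ∈ K ∪ K' := by
      rw [hunion]
      exact apply_incl_boundary h z
    exact hmem.resolve_right hz
  · intro hz hz'
    exact Set.disjoint_left.1 hdisj hz hz'

/-- The open piece off a closed set is compact when `M` is (it is closed in the compact
boundary `∂Mᵃ` as soon as `f⁻¹(a) = K ⊔ K'`). [folklore] -/
theorem compactSpace_boundaryPieceOff [T2Space M] [CompactSpace M] {K K' : Set M}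
    (hK : IsClosed K) {hK' : IsClosed K'} (hdisj : Disjoint K K') (hunion : K ∪ K' = f ⁻¹' {a}) :
    CompactSpace (boundaryPieceOff h K' hK') := by
  haveI : CompactSpace ((𝓡∂ (k + 1)).boundary (RegularSublevel h)) :=
    compactSpace_boundary k (RegularSublevel h)
  refine isCompact_iff_compactSpace.1 ?_
  rw [coe_boundaryPieceOff_eq h hdisj hunion]
  have hc : Continuous fun z : (𝓡∂ (k + 1)).boundary (RegularSublevel h) => incl h z.1 :=
    (continuous_incl h).comp continuous_subtype_val
  exact (hK.preimage hc).isCompact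

/-- The open piece off `K'` is non-empty as soon as `K` is, when `f⁻¹(a) = K ⊔ K'`. [folklore] -/
theorem nonempty_boundaryPieceOff {K K' : Set M} {hK' : IsClosed K'} (hdisj : Disjoint K K')
    (hunion : K ∪ K' = f ⁻¹' {a}) (hne : K.Nonempty) : Nonempty (boundaryPieceOff h K' hK') := by
  obtain ⟨x, hx⟩ := hne
  have hxa : f x = a := by
    have : x ∈ f ⁻¹' {a} := hunion ▸ Or.inl hx
    exact this
  refine ⟨⟨⟨mk h x hxa.le, (mem_boundary_iff h _).2 hxa⟩, ?_⟩⟩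
  show incl h (mk h x hxa.le) ∉ K'
  rw [incl_mk]
  exact Set.disjoint_left.1 hdisj hx

/-- **A regular sublevel set with split boundary level is a cobordism between the two pieces**
(Milnor 1965, Def. 1.1 with Lemma 2.9; Milnor 1963, Thm. 3.1): if `f⁻¹(a) = K ⊔ K'` with `K`,
`K'` closed and disjoint, then `Mᵃ = {f ≤ a}` is a cobordism from (the open piece of `∂Mᵃ`
over) `K` to (that over) `K'`, both embedded by the boundary inclusion.
[cite: MilnorHCobordism1965, Def. 1.1 and Lemma 2.9 (PDF pp. 2, 11)] [cite: Milnor1963, Thm. 3.1] -/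
def splitCobordism [T2Space M] [SecondCountableTopology M] [CompactSpace M] {K K' : Set M}
    (hK : IsClosed K) (hK' : IsClosed K') (hdisj : Disjoint K K') (hunion : K ∪ K' = f ⁻¹' {a}) :
    Cobordism k (boundaryPieceOff h K' hK') (boundaryPieceOff h K hK) where
  W := RegularSublevel h
  inl p := (p.1 : RegularSublevel h)
  inr p := (p.1 : RegularSublevel h)
  isSmoothEmbedding_inl := BoundaryManifold.isSmoothEmbedding_opens_val _
  isSmoothEmbedding_inr := BoundaryManifold.isSmoothEmbedding_opens_val _
  disjoint_range := by
    refine Set.disjoint_left.2 ?_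
    rintro z ⟨p, rfl⟩ ⟨q, hq⟩
    have hpK : incl h p.1.1 ∈ K := incl_mem_of_boundaryPieceOff h hunion p
    have hqK' : incl h q.1.1 ∈ K' :=
      incl_mem_of_boundaryPieceOff h ((union_comm K' K).trans hunion) q
    have hpq : (q.1 : RegularSublevel h) = p.1 := hq
    rw [hpq] at hqK'
    exact Set.disjoint_left.1 hdisj hpK hqK'
  range_inl_union_range_inr := by
    ext z
    simp only [mem_union, mem_range]
    constructor
    · rintro (⟨p, rfl⟩ | ⟨p, rfl⟩)
      · exact p.1.2
      · exact p.1.2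
    · intro hz
      have hza : f (incl h z) = a := (mem_boundary_iff h z).1 hz
      have hmem : incl h z ∈ K ∪ K' := by rw [hunion]; exact hza
      rcases hmem with hzK | hzK'
      · exact Or.inl ⟨⟨⟨z, hz⟩, Set.disjoint_left.1 hdisj hzK⟩, rfl⟩
      · exact Or.inr ⟨⟨⟨z, hz⟩, Set.disjoint_right.1 hdisj hzK'⟩, rfl⟩

/-- The total space of the split cobordism is `Mᵃ` (definitional). [folklore] -/
@[simp]
theorem splitCobordism_W [T2Space M] [SecondCountableTopology M] [CompactSpace M] {K K' : Set M}
    (hK : IsClosed K) (hK' : IsClosed K') (hdisj : Disjoint K K') (hunion : K ∪ K' = f ⁻¹' {a}) :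
    (splitCobordism h hK hK' hdisj hunion).W = RegularSublevel h :=
  rfl

/-- The incoming inclusion of the split cobordism is the boundary inclusion (definitional).
[folklore] -/
@[simp]
theorem splitCobordism_inl [T2Space M] [SecondCountableTopology M] [CompactSpace M]
    {K K' : Set M} (hK : IsClosed K) (hK' : IsClosed K') (hdisj : Disjoint K K')
    (hunion : K ∪ K' = f ⁻¹' {a}) (p : boundaryPieceOff h K' hK') :
    (splitCobordism h hK hK' hdisj hunion).inl p = (p.1 : RegularSublevel h) :=
  rfl

/-- The outgoing inclusion of the split cobordism is the boundary inclusion (definitional).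
[folklore] -/
@[simp]
theorem splitCobordism_inr [T2Space M] [SecondCountableTopology M] [CompactSpace M]
    {K K' : Set M} (hK : IsClosed K) (hK' : IsClosed K') (hdisj : Disjoint K K')
    (hunion : K ∪ K' = f ⁻¹' {a}) (p : boundaryPieceOff h K hK) :
    (splitCobordism h hK hK' hdisj hunion).inr p = (p.1 : RegularSublevel h) :=
  rfl

end Split

end RegularSublevel

/-! ### The lowest saddle of a Morse function with one minimum and one maximum -/

section Surface

open Flow MilnorBox

variable {M : Type u} [TopologicalSpace M] [ChartedSpace (EuclideanSpace ℝ (Fin 2)) M]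
  [IsManifold (𝓡 2) ∞ M] [T2Space M] [CompactSpace M]

/-- **The lowest-saddle configuration** (`LowestSaddle`, `SaddleLevelCircle.lean`) of a Morse
function on a closed surface with exactly one critical point of index `0`, exactly one of index
`2` and at least one saddle: after shifting below `1` and separating the critical values
(Milnor 1965, Lemma 2.8 / Thm. 4.1; the critical sets of each index are unchanged) and choosing
a gradient-like field (Milnor 1965, Lemma 3.2) and Milnor boxes (Def. 3.1 (2)), the lowest
saddle `s` is alone on its level, only the minimum lies below it, and every other critical
point lies above `f s + η`.  This is the construction of `HomotopyTwoSphereNoSaddle.lean`,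
recorded as a theorem. [cite: MilnorHCobordism1965, Lemma 2.8, Lemma 3.2, Def. 3.1 (2), Thm. 4.1]
[cite: Matsumoto2001, §1.5 (b) (PDF pp. 48–49)] -/
theorem exists_lowestSaddle {f : M → ℝ} (hfM : IsMorse (𝓡 2) f) {pbot ptop s₀ : M}
    (hbot : criticalSetOfIndex (𝓡 2) f 0 = {pbot}) (htop : criticalSetOfIndex (𝓡 2) f 2 = {ptop})
    (hs₀ : s₀ ∈ criticalSetOfIndex (𝓡 2) f 1) :
    ∃ (g : M → ℝ) (ξ : Π x : M, TangentSpace (𝓡 2) x) (S : LowestSaddle g ξ),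
      (∀ k, criticalSetOfIndex (𝓡 2) g k = criticalSetOfIndex (𝓡 2) f k) ∧
      S.pmin = pbot ∧ S.sad ∈ criticalSetOfIndex (𝓡 2) g 1 := by
  classical
  haveI : Nonempty M := ⟨pbot⟩
  -- Step 1: shift below `1` and separate the critical values
  obtain ⟨x₁, -, hx₁⟩ := isCompact_univ.exists_isMaxOn univ_nonempty hfM.contMDiff.continuous.continuousOn
  set C := f x₁ + 1 with hC
  set f₀ : M → ℝ := fun y => f y - C with hf₀
  obtain ⟨hf₀M, hcrit₀, hidx₀⟩ := isMorse_sub_const_and hfM C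
  have hlt₀ : ∀ y, f₀ y < 1 := fun y => by
    have h1 : f y ≤ f x₁ := hx₁ (mem_univ y)
    show f y - (f x₁ + 1) < 1
    linarith
  have hadapt : IsMorseAdapted (𝓡 2) f₀ := by
    refine ⟨hf₀M, fun x hx => ?_, fun x _ => hlt₀ x⟩
    rw [ModelWithCorners.Boundaryless.boundary_eq_empty] at hx
    exact hx.elim
  obtain ⟨g, hg, hcritg, hidxg, hinj⟩ :=
    hadapt.exists_injOn_criticalSet (IsMorse.finite_criticalSet_holds hf₀M)
  have hgM : IsMorse (𝓡 2) g := hg.1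
  -- critical sets and indices of `g` agree with those of `f`
  have hcritgf : criticalSet (𝓡 2) g = criticalSet (𝓡 2) f := hcritg.trans hcrit₀
  have hidxgf : ∀ q ∈ criticalSet (𝓡 2) f, morseIndex (𝓡 2) g q = morseIndex (𝓡 2) f q :=
    fun q hq => (hidxg q (hcrit₀.symm ▸ hq)).trans (hidx₀ q)
  have hCOI : ∀ k, criticalSetOfIndex (𝓡 2) g k = criticalSetOfIndex (𝓡 2) f k := fun k => by
    ext q
    simp only [mem_criticalSetOfIndex]
    constructor
    · rintro ⟨hq, hk⟩
      have hq' : q ∈ criticalSet (𝓡 2) f := hcritgf ▸ (hq : q ∈ criticalSet (𝓡 2) g)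
      exact ⟨hq', (hidxgf q hq') ▸ hk⟩
    · rintro ⟨hq, hk⟩
      have hq' : q ∈ criticalSet (𝓡 2) g := hcritgf.symm ▸ (hq : q ∈ criticalSet (𝓡 2) f)
      exact ⟨hq', (hidxgf q hq).symm ▸ hk⟩
  have hbotg : criticalSetOfIndex (𝓡 2) g 0 = {pbot} := (hCOI 0).trans hbot
  have htopg : criticalSetOfIndex (𝓡 2) g 2 = {ptop} := (hCOI 2).trans htop
  have hsadg : s₀ ∈ criticalSetOfIndex (𝓡 2) g 1 := (hCOI 1).symm ▸ hs₀
  -- Step 2: gradient-like field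
  obtain ⟨ξ, hgl⟩ := hgM.exists_isGradientLike fun p _ => BoundarylessManifold.isInteriorPoint
  have hξ : ContMDiff (𝓡 2) (𝓡 2).tangent ∞ fun x => (⟨x, ξ x⟩ : TangentBundle (𝓡 2) M) :=
    ξ.contMDiff
  -- Step 3: the lowest saddle
  have hfinT : (criticalSetOfIndex (𝓡 2) g 1).Finite :=
    (IsMorse.finite_criticalSet_holds hgM).subset (criticalSetOfIndex_subset (𝓡 2) g 1)
  obtain ⟨s, hsT, hsmin⟩ := hfinT.toFinset.exists_min_image g ⟨s₀, hfinT.mem_toFinset.2 hsadg⟩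
  rw [hfinT.mem_toFinset] at hsT
  have hsmin' : ∀ s' ∈ criticalSetOfIndex (𝓡 2) g 1, g s ≤ g s' := fun s' hs' =>
    hsmin s' (hfinT.mem_toFinset.2 hs')
  have hs_crit : IsMCriticalPt (𝓡 2) g s := ((mem_criticalSetOfIndex).1 hsT).1
  have hs_idx : morseIndex (𝓡 2) g s = 1 := ((mem_criticalSetOfIndex).1 hsT).2
  -- the minimum: global minimum point, index `0`, hence `pbot`
  have hpbot_mem : pbot ∈ criticalSetOfIndex (𝓡 2) g 0 := by rw [hbotg]; exact mem_singleton _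
  have hpbot_crit : IsMCriticalPt (𝓡 2) g pbot := ((mem_criticalSetOfIndex).1 hpbot_mem).1
  have hpbot_idx : morseIndex (𝓡 2) g pbot = 0 := ((mem_criticalSetOfIndex).1 hpbot_mem).2
  obtain ⟨x₀, -, hx₀⟩ := isCompact_univ.exists_isMinOn univ_nonempty hgM.contMDiff.continuous.continuousOn
  have hx₀loc : IsLocalMin g x₀ := hx₀.isLocalMin univ_mem
  have hx₀crit : IsMCriticalPt (𝓡 2) g x₀ := IsLocalMin.isMCriticalPt hx₀loc
  have hx₀idx : morseIndex (𝓡 2) g x₀ = 0 := hgM.morseIndex_eq_zero_of_isLocalMin hx₀loc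
  have hx₀bot : x₀ = pbot := by
    have : x₀ ∈ criticalSetOfIndex (𝓡 2) g 0 := (mem_criticalSetOfIndex).2 ⟨hx₀crit, hx₀idx⟩
    rw [hbotg] at this; exact this
  have hmin_le : ∀ y, g pbot ≤ g y := fun y => by rw [← hx₀bot]; exact hx₀ (mem_univ y)
  -- values
  have hps : pbot ≠ s := fun h => by rw [h, hs_idx] at hpbot_idx; exact one_ne_zero hpbot_idx
  have hm_lt_c : g pbot < g s := lt_of_le_of_ne (hmin_le s) fun h => hps (hinj hpbot_crit hs_crit h)
  -- all other critical points lie strictly above `g s`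
  have habove : ∀ q, IsMCriticalPt (𝓡 2) g q → q ≠ pbot → q ≠ s → g s < g q := by
    intro q hq hqb hqs
    have hle := morseIndex_le_finrank (𝓡 2) g q
    rw [finrank_euclideanSpace_fin] at hle
    have hge : g s ≤ g q := by
      rcases Nat.lt_or_ge (morseIndex (𝓡 2) g q) 1 with h0 | h1
      · have : q ∈ criticalSetOfIndex (𝓡 2) g 0 := (mem_criticalSetOfIndex).2 ⟨hq, by omega⟩
        rw [hbotg] at this; exact absurd this hqb
      rcases h1.eq_or_lt with h1 | h2
      · exact hsmin' q ((mem_criticalSetOfIndex).2 ⟨hq, h1.symm⟩)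
      · have h2' : morseIndex (𝓡 2) g q = 2 := by omega
        have hqt : q ∈ criticalSetOfIndex (𝓡 2) g 2 := (mem_criticalSetOfIndex).2 ⟨hq, h2'⟩
        rw [htopg] at hqt
        -- `ptop` is the global maximum
        obtain ⟨y₀, -, hy₀⟩ := isCompact_univ.exists_isMaxOn univ_nonempty hgM.contMDiff.continuous.continuousOn
        have hy₀loc : IsLocalMax g y₀ := hy₀.isLocalMax univ_mem
        have hy₀crit : IsMCriticalPt (𝓡 2) g y₀ := IsLocalMax.isMCriticalPt hy₀loc
        have hy₀idx : morseIndex (𝓡 2) g y₀ = 2 := by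
          have := hgM.morseIndex_eq_finrank_of_isLocalMax hy₀loc
          simpa [finrank_euclideanSpace_fin] using this
        have hy₀top : y₀ = ptop := by
          have : y₀ ∈ criticalSetOfIndex (𝓡 2) g 2 := (mem_criticalSetOfIndex).2 ⟨hy₀crit, hy₀idx⟩
          rw [htopg] at this; exact this
        rw [show q = ptop from hqt, ← hy₀top]
        exact hy₀ (mem_univ s)
    exact lt_of_le_of_ne hge fun h => hqs (hinj hq hs_crit h.symm)
  -- the gap
  set R : Set M := criticalSet (𝓡 2) g \ {pbot, s} with hR
  have hRfin : R.Finite := (IsMorse.finite_criticalSet_holds hgM).subset Set.sdiff_subset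
  obtain ⟨η, hη, hηR⟩ : ∃ η : ℝ, 0 < η ∧ ∀ q ∈ R, g s + η ≤ g q := by
    by_cases hRne : R.Nonempty
    · obtain ⟨q₀, hq₀, hq₀min⟩ := hRfin.toFinset.exists_min_image g
        ((Set.Finite.toFinset_nonempty hRfin).2 hRne)
      rw [hRfin.mem_toFinset] at hq₀
      refine ⟨g q₀ - g s, sub_pos.2 (habove q₀ hq₀.1 (fun h => hq₀.2 (Or.inl h))
        (fun h => hq₀.2 (Or.inr h))), fun q hq => ?_⟩
      have := hq₀min q (hRfin.mem_toFinset.2 hq); linarith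
    · exact ⟨1, one_pos, fun q hq => absurd ⟨q, hq⟩ hRne⟩
  -- Step 4: Milnor boxes and parameters
  obtain ⟨Dmin⟩ := hgl.nonempty_milnorBox hpbot_crit
  obtain ⟨Dsad⟩ := hgl.nonempty_milnorBox hs_crit
  have hkmin : Dmin.k = 0 := by
    have h := Dmin.min_k_eq_morseIndex hgM
    rw [hpbot_idx] at h
    rcases Nat.lt_or_ge Dmin.k 2 with h' | h'
    · rw [min_eq_right h'.le] at h; exact h
    · rw [min_eq_left h'] at h; exact absurd h (by norm_num)
  have hksad : Dsad.k = 1 := by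
    have h := Dsad.min_k_eq_morseIndex hgM
    rw [hs_idx] at h
    rcases Nat.lt_or_ge Dsad.k 2 with h' | h'
    · rw [min_eq_right h'.le] at h; exact h
    · rw [min_eq_left h'] at h; exact absurd h (by norm_num)
  set gap := g s - g pbot with hgap
  have hgap_pos : 0 < gap := sub_pos.2 hm_lt_c
  set κ := min (min η (Dsad.ε ^ 2)) gap / 4 with hκ
  have hεs := Dsad.eps_pos
  have hεm := Dmin.eps_pos
  have hminpos : 0 < min (min η (Dsad.ε ^ 2)) gap := lt_min (lt_min hη (by positivity)) hgap_pos
  have hκ_pos : 0 < κ := by positivity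
  have hκ_le_η : κ ≤ η / 4 := by
    have := min_le_left (min η (Dsad.ε ^ 2)) gap; have := min_le_left η (Dsad.ε ^ 2)
    simp only [hκ]; linarith
  have hκ_le_ε : κ ≤ Dsad.ε ^ 2 / 4 := by
    have := min_le_left (min η (Dsad.ε ^ 2)) gap; have := min_le_right η (Dsad.ε ^ 2)
    simp only [hκ]; linarith
  have hκ_le_gap : κ ≤ gap / 4 := by
    have := min_le_right (min η (Dsad.ε ^ 2)) gap; simp only [hκ]; linarith
  set ρ2 := min (Dmin.ε ^ 2) (gap / 4) with hρ2
  have hρ2_pos : 0 < ρ2 := lt_min (by positivity) (by positivity)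
  set ρ := Real.sqrt ρ2 with hρ
  have hρ_sq : ρ ^ 2 = ρ2 := Real.sq_sqrt hρ2_pos.le
  -- the configuration
  let S : LowestSaddle g ξ :=
    { pmin := pbot, sad := s, Dmin := Dmin, Dsad := Dsad, isMorse := hgM, isGradientLike := hgl,
      contMDiff := hξ, kmin := hkmin, ksad := hksad, η := η, κ := κ, δ := κ, ρ := ρ,
      η_pos := hη, κ_pos := hκ_pos, δ_pos := hκ_pos, ρ_pos := Real.sqrt_pos.2 hρ2_pos,
      κ_lt_η := by linarith, δ_lt_η := by linarith,
      κ_lt := by nlinarith, δ_lt := by nlinarith,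
      ρ_lt := by rw [hρ_sq]; have := min_le_left (Dmin.ε ^ 2) (gap / 4); nlinarith,
      base_lt := by
        rw [hρ_sq]; have := min_le_right (Dmin.ε ^ 2) (gap / 4)
        simp only [hgap] at this hκ_le_gap ⊢; linarith,
      crit_ge := fun q hq hqb hqs => hηR q ⟨hq, fun h => by
        rcases h with h | h
        · exact hqb h
        · exact hqs h⟩ }
  exact ⟨g, ξ, S, hCOI, rfl, hsT⟩

/-! ### Values of the critical points relative to the level `hi = f(sad) + δ` -/

namespace LowestSaddle

omit [T2Space M] [CompactSpace M] in
/-- The minimum lies strictly below the level `hi`. [folklore] -/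
theorem min_lt_hi {f : M → ℝ} {ξ : Π x : M, TangentSpace (𝓡 2) x} (S : LowestSaddle f ξ) :
    f S.pmin < S.hi :=
  S.min_lt_base.trans (S.base_lt_lo.trans (S.lo_lt_sad.trans S.sad_lt_hi))

omit [T2Space M] [CompactSpace M] in
/-- Every critical point other than the minimum and the lowest saddle lies strictly above the
level `hi = f(sad) + δ` (`δ < η`). [folklore] -/
theorem hi_lt_of_ne {f : M → ℝ} {ξ : Π x : M, TangentSpace (𝓡 2) x} (S : LowestSaddle f ξ)
    {q : M} (hq : IsMCriticalPt (𝓡 2) f q) (h1 : q ≠ S.pmin) (h2 : q ≠ S.sad) : S.hi < f q :=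
  S.hi_lt_gap.trans_le (S.crit_ge q hq h1 h2)

omit [T2Space M] [CompactSpace M] in
/-- A critical point with value `≤ hi` is the minimum or the lowest saddle. [folklore] -/
theorem eq_or_eq_of_le_hi {f : M → ℝ} {ξ : Π x : M, TangentSpace (𝓡 2) x} (S : LowestSaddle f ξ)
    {q : M} (hq : IsMCriticalPt (𝓡 2) f q) (hle : f q ≤ S.hi) : q = S.pmin ∨ q = S.sad := by
  by_contra hcon
  rw [not_or] at hcon
  exact absurd hle (not_le.2 (S.hi_lt_of_ne hq hcon.1 hcon.2))

end LowestSaddle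

/-! ### The cutting theorem -/

/-- **Cutting a closed oriented surface between its two saddles: both halves are cylinders.**
On a closed smooth surface `M` carrying a smooth orientation, let `f` be a Morse function with
exactly one critical point of index `0`, exactly one of index `2`, and exactly two of index `1`.
Then there are a Morse function `g` with the same critical sets of each index (the usual
normalisation of `f`) and a regular level `c` of `g` such that:
the level `g⁻¹(c)` is the disjoint union of two non-empty closed sets `K`, `K'`, and both the
sublevel set `{g ≤ c}` and the superlevel set `{c ≤ g}` — compact surfaces with boundary
`g⁻¹(c)` — are PRODUCT cobordisms from `K` to `K'` (`Cobordism.IsTrivial`: diffeomorphic to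
`K × [0, 1]` relative to `K`).  Proof: take for `c` the level just above the lowest saddle
(`exists_lowestSaddle`); the level splits because the surface is oriented
(`LowestSaddle.exists_level_split`, Matsumoto 2002 §1.5 (b): the `1`-handle is untwisted); each
half is connected (one minimum, resp. one maximum; Reeb) with Morse count `1 - 1 = 0`, hence
Euler characteristic `0` (Morse equality), and the cylinder theorem
`Cobordism.isTrivial_of_relEuler_empty_eq_zero` applies.
[cite: HirschDT1976, Ch. 9 §3, proof of Thm. 3.5 with Lemma 3.2 and Thm. 3.7 (PDF pp. 186–189)]
[cite: Matsumoto2001, §1.5 (b) (PDF pp. 48–49) and Thm. 3.35]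
[cite: MilnorHCobordism1965, Lemma 2.9, Thm. 3.4, Thm. 8.1 Index 0] -/
theorem exists_isTrivial_sublevel_superlevel [SecondCountableTopology M]
    (o : SmoothOrientation (𝓡 2) M) {f : M → ℝ} (hfM : IsMorse (𝓡 2) f) {pbot ptop : M}
    (hbot : criticalSetOfIndex (𝓡 2) f 0 = {pbot}) (htop : criticalSetOfIndex (𝓡 2) f 2 = {ptop})
    (hsad : (criticalSetOfIndex (𝓡 2) f 1).ncard = 2) :
    ∃ (g : M → ℝ) (c : ℝ) (_ : IsMorse (𝓡 2) g) (h : IsRegularLevel (𝓡 2) g c) (K K' : Set M)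
      (hK : IsClosed K) (hK' : IsClosed K') (hdisj : Disjoint K K')
      (hunion : K ∪ K' = g ⁻¹' {c}) (hunion' : K ∪ K' = (fun y => c - g y) ⁻¹' {0}),
      (∀ k, criticalSetOfIndex (𝓡 2) g k = criticalSetOfIndex (𝓡 2) f k) ∧
      K.Nonempty ∧ K'.Nonempty ∧
      (RegularSublevel.splitCobordism h hK hK' hdisj hunion).IsTrivial ∧
      (RegularSublevel.splitCobordism h.const_sub hK hK' hdisj hunion').IsTrivial := by
  classical
  -- a saddle exists
  have hfin1 : (criticalSetOfIndex (𝓡 2) f 1).Finite :=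
    (IsMorse.finite_criticalSet_holds hfM).subset (criticalSetOfIndex_subset (𝓡 2) f 1)
  obtain ⟨s₀, hs₀⟩ : (criticalSetOfIndex (𝓡 2) f 1).Nonempty :=
    Set.nonempty_of_ncard_ne_zero (by rw [hsad]; norm_num)
  -- the lowest saddle configuration of the normalised function `g`
  obtain ⟨g, ξ, S, hCOI, hpmin, hsad1⟩ := exists_lowestSaddle hfM hbot htop hs₀
  have hgM : IsMorse (𝓡 2) g := S.isMorse
  have hbotg : criticalSetOfIndex (𝓡 2) g 0 = {S.pmin} := by rw [hCOI 0, hbot, hpmin]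
  have htopg : criticalSetOfIndex (𝓡 2) g 2 = {ptop} := (hCOI 2).trans htop
  have hsadg : (criticalSetOfIndex (𝓡 2) g 1).ncard = 2 := by rw [hCOI 1, hsad]
  have hfing1 : (criticalSetOfIndex (𝓡 2) g 1).Finite :=
    (IsMorse.finite_criticalSet_holds hgM).subset (criticalSetOfIndex_subset (𝓡 2) g 1)
  have hsad_idx : morseIndex (𝓡 2) g S.sad = 1 := ((mem_criticalSetOfIndex).1 hsad1).2
  have hpmin_idx : morseIndex (𝓡 2) g S.pmin = 0 := by
    have : S.pmin ∈ criticalSetOfIndex (𝓡 2) g 0 := by rw [hbotg]; exact mem_singleton _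
    exact ((mem_criticalSetOfIndex).1 this).2
  have hptop_mem : ptop ∈ criticalSetOfIndex (𝓡 2) g 2 := by rw [htopg]; exact mem_singleton _
  have hptop_crit : IsMCriticalPt (𝓡 2) g ptop := ((mem_criticalSetOfIndex).1 hptop_mem).1
  have hptop_idx : morseIndex (𝓡 2) g ptop = 2 := ((mem_criticalSetOfIndex).1 hptop_mem).2
  have hptop_ne_pmin : ptop ≠ S.pmin := fun heq => by
    rw [heq, hpmin_idx] at hptop_idx; exact absurd hptop_idx (by norm_num)
  have hptop_ne_sad : ptop ≠ S.sad := fun heq => by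
    rw [heq, hsad_idx] at hptop_idx; exact absurd hptop_idx (by norm_num)
  have hsad_ne_pmin : S.sad ≠ S.pmin := fun heq => by
    rw [heq, hpmin_idx] at hsad_idx; exact absurd hsad_idx (by norm_num)
  -- the level `c = hi` and its regularity
  set c := S.hi with hc
  have hreg : IsRegularLevel (𝓡 2) g c :=
    hgM.isRegularLevel fun z hz hzc => S.not_isMCriticalPt_of_hi hzc hz
  -- values
  have hpmin_lt : g S.pmin < c := S.min_lt_hi
  have hsad_lt : g S.sad < c := S.sad_lt_hi
  have hptop_gt : c < g ptop := S.hi_lt_of_ne hptop_crit hptop_ne_pmin hptop_ne_sad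
  -- the splitting of the level (orientation!)
  obtain ⟨K, K', hK, hK', hdisj, hunion₀, hKne, hK'ne⟩ := S.exists_level_split o
  have hunion : K ∪ K' = g ⁻¹' {c} := hunion₀
  have hunion' : K ∪ K' = (fun y => c - g y) ⁻¹' {0} := by
    rw [hunion]
    ext y
    simp only [mem_preimage, mem_singleton_iff, sub_eq_zero]
    exact eq_comm
  -- critical points below and above `c`
  have hcrit0_le : criticalSetOfIndex (𝓡 2) g 0 ∩ g ⁻¹' Iic c = {S.pmin} := by
    rw [hbotg]
    ext q
    simp only [mem_inter_iff, mem_singleton_iff, mem_preimage, mem_Iic]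
    exact ⟨fun hq => hq.1, fun hq => ⟨hq, hq ▸ hpmin_lt.le⟩⟩
  have hcrit1_le : criticalSetOfIndex (𝓡 2) g 1 ∩ g ⁻¹' Iic c = {S.sad} := by
    ext q
    simp only [mem_inter_iff, mem_singleton_iff, mem_preimage, mem_Iic, mem_criticalSetOfIndex]
    constructor
    · rintro ⟨⟨hq, hq1⟩, hle⟩
      rcases S.eq_or_eq_of_le_hi hq hle with h0 | h1
      · rw [h0, hpmin_idx] at hq1; exact absurd hq1 (by norm_num)
      · exact h1
    · rintro rfl
      exact ⟨⟨S.isMCriticalPt_sad, hsad_idx⟩, hsad_lt.le⟩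
  have hcrit2_le : criticalSetOfIndex (𝓡 2) g 2 ∩ g ⁻¹' Iic c = ∅ := by
    rw [htopg]
    ext q
    simp only [mem_inter_iff, mem_singleton_iff, mem_preimage, mem_Iic, mem_empty_iff_false,
      iff_false, not_and, not_le]
    rintro rfl
    exact hptop_gt
  have hcrit0_ge : criticalSetOfIndex (𝓡 2) g 0 ∩ (fun y => c - g y) ⁻¹' Iic 0 = ∅ := by
    rw [hbotg]
    ext q
    simp only [mem_inter_iff, mem_singleton_iff, mem_preimage, mem_Iic, mem_empty_iff_false,
      iff_false, not_and, not_le, sub_pos]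
    rintro rfl
    exact hpmin_lt
  have hcrit1_ge : criticalSetOfIndex (𝓡 2) g 1 ∩ (fun y => c - g y) ⁻¹' Iic 0 =
      criticalSetOfIndex (𝓡 2) g 1 \ {S.sad} := by
    ext q
    simp only [mem_inter_iff, mem_preimage, mem_Iic, sub_nonpos, Set.mem_sdiff, mem_singleton_iff,
      mem_criticalSetOfIndex]
    constructor
    · rintro ⟨hq, hle⟩
      exact ⟨hq, fun heq => by rw [heq] at hle; exact absurd hle (not_le.2 hsad_lt)⟩
    · rintro ⟨⟨hq, hq1⟩, hne⟩
      refine ⟨⟨hq, hq1⟩, ?_⟩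
      have hne' : q ≠ S.pmin := fun heq => by
        rw [heq, hpmin_idx] at hq1; exact absurd hq1 (by norm_num)
      exact (S.hi_lt_of_ne hq hne' hne).le
  have hcrit2_ge : criticalSetOfIndex (𝓡 2) g 2 ∩ (fun y => c - g y) ⁻¹' Iic 0 = {ptop} := by
    rw [htopg]
    ext q
    simp only [mem_inter_iff, mem_singleton_iff, mem_preimage, mem_Iic, sub_nonpos]
    exact ⟨fun hq => hq.1, fun hq => ⟨hq, hq ▸ hptop_gt.le⟩⟩
  -- the sublevel set `{g ≤ c}`
  haveI hconn : ConnectedSpace (RegularSublevel hreg) :=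
    RegularSublevel.connectedSpace hreg (by rw [hbotg]; exact subsingleton_singleton)
      ⟨S.pmin, hpmin_lt.le⟩
  haveI hneK : Nonempty (RegularSublevel.boundaryPieceOff hreg K' hK') :=
    RegularSublevel.nonempty_boundaryPieceOff hreg hdisj hunion hKne
  haveI hneK' : Nonempty (RegularSublevel.boundaryPieceOff hreg K hK) :=
    RegularSublevel.nonempty_boundaryPieceOff hreg hdisj.symm ((union_comm K' K).trans hunion) hK'ne
  haveI hcK : CompactSpace (RegularSublevel.boundaryPieceOff hreg K' hK') :=
    RegularSublevel.compactSpace_boundaryPieceOff hreg hK hdisj hunion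
  haveI hcK' : CompactSpace (RegularSublevel.boundaryPieceOff hreg K hK) :=
    RegularSublevel.compactSpace_boundaryPieceOff hreg hK' hdisj.symm ((union_comm K' K).trans hunion)
  have hcrit2_le' : criticalSetOfIndex (𝓡 2) g (1 + 1) ∩ g ⁻¹' Iic c = ∅ := hcrit2_le
  have hχ₁ : relEuler ℤ ℤ (RegularSublevel hreg) ∅ = 0 := by
    obtain ⟨-, hsum⟩ := (RegularSublevel.morseData hgM hreg).1.finRelHomology_empty ℤ ℤ
    rw [hsum, Module.finrank_self, Nat.cast_one, mul_one, Finset.sum_range_succ,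
      Finset.sum_range_succ, Finset.sum_range_one,
      RegularSublevel.ncard_criticalSetOfIndex hgM hreg 0,
      RegularSublevel.ncard_criticalSetOfIndex hgM hreg 1,
      RegularSublevel.ncard_criticalSetOfIndex hgM hreg (1 + 1), hcrit0_le, hcrit1_le, hcrit2_le']
    simp
  haveI : ConnectedSpace (RegularSublevel.splitCobordism hreg hK hK' hdisj hunion).W := hconn
  have htriv₁ : (RegularSublevel.splitCobordism hreg hK hK' hdisj hunion).IsTrivial :=
    Cobordism.isTrivial_of_relEuler_empty_eq_zero _ hχ₁
  -- the superlevel set `{c ≤ g}`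
  have hgM' : IsMorse (𝓡 2) (fun y => c - g y) := hgM.const_sub c
  haveI hconn' : ConnectedSpace (RegularSuperlevel hreg) :=
    RegularSublevel.connectedSpace_superlevel hgM hreg (by rw [htopg]; exact subsingleton_singleton)
      ⟨ptop, hptop_gt.le⟩
  haveI hneK₂ : Nonempty (RegularSublevel.boundaryPieceOff hreg.const_sub K' hK') :=
    RegularSublevel.nonempty_boundaryPieceOff hreg.const_sub hdisj hunion' hKne
  haveI hneK₂' : Nonempty (RegularSublevel.boundaryPieceOff hreg.const_sub K hK) :=
    RegularSublevel.nonempty_boundaryPieceOff hreg.const_sub hdisj.symm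
      ((union_comm K' K).trans hunion') hK'ne
  haveI hcK₂ : CompactSpace (RegularSublevel.boundaryPieceOff hreg.const_sub K' hK') :=
    RegularSublevel.compactSpace_boundaryPieceOff hreg.const_sub hK hdisj hunion'
  haveI hcK₂' : CompactSpace (RegularSublevel.boundaryPieceOff hreg.const_sub K hK) :=
    RegularSublevel.compactSpace_boundaryPieceOff hreg.const_sub hK' hdisj.symm
      ((union_comm K' K).trans hunion')
  have hflip : ∀ i, i ≤ 2 → criticalSetOfIndex (𝓡 2) (fun y => c - g y) i =
      criticalSetOfIndex (𝓡 2) g (2 - i) := fun i hi => by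
    have h := hgM.criticalSetOfIndex_const_sub c (k := i) (by rw [finrank_euclideanSpace_fin]; exact hi)
    rw [finrank_euclideanSpace_fin] at h
    exact h
  have hflip0 : criticalSetOfIndex (𝓡 2) (fun y => c - g y) 0 ∩ (fun y => c - g y) ⁻¹' Iic 0 =
      {ptop} := by
    rw [hflip 0 (by norm_num)]; exact hcrit2_ge
  have hflip1 : criticalSetOfIndex (𝓡 2) (fun y => c - g y) 1 ∩ (fun y => c - g y) ⁻¹' Iic 0 =
      criticalSetOfIndex (𝓡 2) g 1 \ {S.sad} := by
    rw [hflip 1 (by norm_num)]; exact hcrit1_ge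
  have hflip2 : criticalSetOfIndex (𝓡 2) (fun y => c - g y) (1 + 1) ∩ (fun y => c - g y) ⁻¹' Iic 0 =
      ∅ := by
    rw [hflip (1 + 1) le_rfl]; exact hcrit0_ge
  have hdiff_ncard : (criticalSetOfIndex (𝓡 2) g 1 \ {S.sad}).ncard = 1 := by
    have h := Set.ncard_sdiff_singleton_of_mem hsad1
    rw [hsadg] at h
    exact h
  have hχ₂ : relEuler ℤ ℤ (RegularSuperlevel hreg) ∅ = 0 := by
    obtain ⟨-, hsum⟩ := (RegularSublevel.morseData hgM' hreg.const_sub).1.finRelHomology_empty ℤ ℤ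
    rw [hsum, Module.finrank_self, Nat.cast_one, mul_one, Finset.sum_range_succ,
      Finset.sum_range_succ, Finset.sum_range_one,
      RegularSublevel.ncard_criticalSetOfIndex hgM' hreg.const_sub 0,
      RegularSublevel.ncard_criticalSetOfIndex hgM' hreg.const_sub 1,
      RegularSublevel.ncard_criticalSetOfIndex hgM' hreg.const_sub (1 + 1), hflip0, hflip1, hflip2,
      hdiff_ncard]
    simp
  haveI : ConnectedSpace (RegularSublevel.splitCobordism hreg.const_sub hK hK' hdisj hunion').W :=
    hconn'
  have htriv₂ : (RegularSublevel.splitCobordism hreg.const_sub hK hK' hdisj hunion').IsTrivial :=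
    Cobordism.isTrivial_of_relEuler_empty_eq_zero _ hχ₂
  exact ⟨g, c, hgM, hreg, K, K', hK, hK', hdisj, hunion, hunion', hCOI, hKne, hK'ne, htriv₁, htriv₂⟩

/-- **Both halves are cylinders `S¹ × [0, 1]` and the two pieces of the cut level are circles.**
Under the hypotheses of `exists_isTrivial_sublevel_superlevel` (closed surface with a smooth
orientation, Morse function with one minimum, one maximum, two saddles) there are a Morse
function `g` with the same critical sets and a regular level `c` of `g` such that `{g ≤ c}` and
`{c ≤ g}` are both diffeomorphic to `S¹ × [0, 1]` (Hirsch 1976, Ch. 9 §3: the surface is a disc,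
two `1`-handles and a disc; here regrouped as two annuli).
[cite: HirschDT1976, Ch. 9 §3, proof of Thm. 3.5 and Thm. 3.7 (PDF pp. 188–189)]
[cite: Matsumoto2001, §1.5 (b) (PDF pp. 48–49)] -/
theorem exists_nonempty_diffeomorph_sublevel_superlevel_cylinder [SecondCountableTopology M]
    (o : SmoothOrientation (𝓡 2) M) {f : M → ℝ} (hfM : IsMorse (𝓡 2) f) {pbot ptop : M}
    (hbot : criticalSetOfIndex (𝓡 2) f 0 = {pbot}) (htop : criticalSetOfIndex (𝓡 2) f 2 = {ptop})
    (hsad : (criticalSetOfIndex (𝓡 2) f 1).ncard = 2) :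
    ∃ (g : M → ℝ) (c : ℝ) (_ : IsMorse (𝓡 2) g) (h : IsRegularLevel (𝓡 2) g c),
      (∀ k, criticalSetOfIndex (𝓡 2) g k = criticalSetOfIndex (𝓡 2) f k) ∧
      Nonempty (RegularSublevel h ≃ₘ^∞⟮𝓡∂ (1 + 1), (𝓡 1).prod (𝓡∂ 1)⟯
        ((Metric.sphere (0 : EuclideanSpace ℝ (Fin (1 + 1))) 1) × (Set.Icc (0 : ℝ) 1))) ∧
      Nonempty (RegularSuperlevel h ≃ₘ^∞⟮𝓡∂ (1 + 1), (𝓡 1).prod (𝓡∂ 1)⟯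
        ((Metric.sphere (0 : EuclideanSpace ℝ (Fin (1 + 1))) 1) × (Set.Icc (0 : ℝ) 1))) := by
  obtain ⟨g, c, hgM, hreg, K, K', hK, hK', hdisj, hunion, hunion', hCOI, hKne, hK'ne, htriv₁, htriv₂⟩ :=
    exists_isTrivial_sublevel_superlevel o hfM hbot htop hsad
  haveI : CompactSpace (RegularSublevel.boundaryPieceOff hreg K' hK') :=
    RegularSublevel.compactSpace_boundaryPieceOff hreg hK hdisj hunion
  haveI : CompactSpace (RegularSublevel.boundaryPieceOff hreg K hK) :=
    RegularSublevel.compactSpace_boundaryPieceOff hreg hK' hdisj.symm ((union_comm K' K).trans hunion)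
  haveI : CompactSpace (RegularSublevel.boundaryPieceOff hreg.const_sub K' hK') :=
    RegularSublevel.compactSpace_boundaryPieceOff hreg.const_sub hK hdisj hunion'
  haveI : CompactSpace (RegularSublevel.boundaryPieceOff hreg.const_sub K hK) :=
    RegularSublevel.compactSpace_boundaryPieceOff hreg.const_sub hK' hdisj.symm
      ((union_comm K' K).trans hunion')
  refine ⟨g, c, hgM, hreg, hCOI, ?_, ?_⟩
  · haveI : ConnectedSpace (RegularSublevel.splitCobordism hreg hK hK' hdisj hunion).W := by
      have hbotg : criticalSetOfIndex (𝓡 2) g 0 = {pbot} := (hCOI 0).trans hbot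
      obtain ⟨x, hx⟩ := hKne
      have hxc : g x = c := show x ∈ g ⁻¹' {c} from hunion ▸ Or.inl hx
      exact RegularSublevel.connectedSpace hreg (by rw [hbotg]; exact subsingleton_singleton)
        ⟨x, hxc.le⟩
    obtain ⟨e⟩ := Cobordism.nonempty_diffeomorph_sphere_one_of_isTrivial _ htriv₁
    obtain ⟨Φ, -⟩ := htriv₁
    exact ⟨Φ.trans (Diffeomorph.prodCongr e (Diffeomorph.refl _ _ _))⟩
  · haveI : ConnectedSpace (RegularSublevel.splitCobordism hreg.const_sub hK hK' hdisj hunion').W := by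
      have htopg : criticalSetOfIndex (𝓡 2) g 2 = {ptop} := (hCOI 2).trans htop
      obtain ⟨x, hx⟩ := hKne
      have hxc : g x = c := show x ∈ g ⁻¹' {c} from hunion ▸ Or.inl hx
      exact RegularSublevel.connectedSpace_superlevel hgM hreg
        (by rw [htopg]; exact subsingleton_singleton) ⟨x, hxc.ge⟩
    obtain ⟨e⟩ := Cobordism.nonempty_diffeomorph_sphere_one_of_isTrivial _ htriv₂
    obtain ⟨Φ, -⟩ := htriv₂
    exact ⟨Φ.trans (Diffeomorph.prodCongr e (Diffeomorph.refl _ _ _))⟩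

end Surface

end Literature.Topology.FourManifolds

end
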